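import Mathlib
import HarnessLib

/-!
# S2 F5b (part 2a): slicing a multivariate polynomial along one variable
(crux stmt-ResolutionOfSingularities-15640 `WildQuotients.WildQuotientResolution`, line `Sketch`;
chain w45c post-V5 programme S2, design `L/res-L1-w45c-lead-1/S2-DESIGN.md` v1.1 §7 (7.7) F5b,
res-L1-w45c-plan-1 RULING 2026-08-27T17:07:17Z (R4) «graded one-variable route».
[OURS · L1 W4.5c] — NOT a statement of the manuscript. Lead prover res-L1-w45c-lead-1.)

Elementary bookkeeping for `B = k[x_σ]` seen as `⨁_{mb : mbᵢ = 0} x^{mb} · k[xᵢ]` — the grading by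
the exponents of the variables other than `i`, used to cut the invariance identity of the
straightened chart into ONE-VARIABLE slices (design (7.7)):

* `coeff_aeval_X` — the coefficients of `g(xᵢ)` for `g ∈ k[X]`;
* `coeff_monomial_mul_aeval_X_of_erase` — the coefficient of `x^{m'}` in `c x^{mb} · g(xᵢ)`
  (`mbᵢ = 0`) is `c · g.coeff (m'ᵢ)` if `mb = m'.erase i` and `0` otherwise;
* **`sliced_eq_zero`** — INDEPENDENCE: `∑_{mb ∈ T} x^{mb} · H_{mb}(xᵢ) = 0` with all `mbᵢ = 0` forces
  every `H_{mb} = 0`;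
* **`eq_sum_slices`** — DECOMPOSITION: `b = ∑_{mb ∈ T} x^{mb} · P_{mb}(xᵢ)` with
  `T = (supp b).image (erase i)` and `P_{mb} = ∑_{a ≤ D} C (b.coeff (mb + a·eᵢ)) X^a` (`slicePoly`).
-/

-- single-problem summit: the doubled namespace component `ResolutionOfSingularities` is forced
set_option linter.dupNamespace false

noncomputable section

open MvPolynomial

namespace Summit.ResolutionOfSingularities.ResolutionOfSingularities.Theorems.WildQuotientResolution.ConductorOne

variable {k : Type} [CommRing k] {σ : Type} [DecidableEq σ] (i : σ)

/-- `m'.erase i ≤ m'`. [folklore] -/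
theorem erase_le_self (m' : σ →₀ ℕ) : m'.erase i ≤ m' := by
  intro l
  by_cases hl : l = i
  · subst hl; rw [Finsupp.erase_same]; exact Nat.zero_le _
  · rw [Finsupp.erase_ne hl]

/-- `m' − m'.erase i = (m' i)·eᵢ`. [folklore] -/
theorem sub_erase_eq_single (m' : σ →₀ ℕ) : m' - m'.erase i = Finsupp.single i (m' i) := by
  ext l
  rw [Finsupp.tsub_apply]
  by_cases hl : l = i
  · subst hl; rw [Finsupp.erase_same, Finsupp.single_eq_same, Nat.sub_zero]
  · rw [Finsupp.erase_ne hl, Finsupp.single_apply, if_neg (fun h => hl h.symm), Nat.sub_self]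

/-- If `mb ≤ m'`, `mbᵢ = 0` and `m' − mb` is supported at `i`, then `mb = m'.erase i`. [folklore] -/
theorem eq_erase_of_sub_eq_single (mb m' : σ →₀ ℕ) (hmb : mb i = 0) (hle : mb ≤ m')
    (hsub : m' - mb = Finsupp.single i ((m' - mb) i)) : mb = m'.erase i := by
  ext l
  by_cases hl : l = i
  · subst hl; rw [Finsupp.erase_same]; exact hmb
  · rw [Finsupp.erase_ne hl]
    have h1 : (m' - mb) l = 0 := by
      rw [hsub, Finsupp.single_apply, if_neg (fun h => hl h.symm)]
    rw [Finsupp.tsub_apply] at h1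
    have h2 : mb l ≤ m' l := hle l
    omega

/-- Coefficients of `g(xᵢ)`: `coeff d (aeval xᵢ g) = g.coeff (d i)` if `d` is supported at `i`,
else `0`. [folklore] -/
theorem coeff_aeval_X (g : Polynomial k) (d : σ →₀ ℕ) :
    coeff d (Polynomial.aeval (X i : MvPolynomial σ k) g) =
      if d = Finsupp.single i (d i) then g.coeff (d i) else 0 := by
  rw [Polynomial.aeval_eq_sum_range (X i : MvPolynomial σ k), coeff_sum]
  simp_rw [MvPolynomial.coeff_smul, coeff_X_pow, smul_eq_mul, mul_ite, mul_one, mul_zero]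
  split_ifs with hd
  · rw [Finset.sum_eq_single (d i)]
    · rw [if_pos hd.symm]
    · intro j _ hne
      rw [if_neg]
      intro h
      apply hne
      have := congrArg (fun f : σ →₀ ℕ => f i) h
      simpa using this
    · intro hnot
      rw [if_pos hd.symm]
      apply Polynomial.coeff_eq_zero_of_natDegree_lt
      simpa [Finset.mem_range, Nat.lt_succ_iff] using hnot
  · apply Finset.sum_eq_zero
    intro j _
    rw [if_neg]
    intro h
    apply hd
    rw [← h]
    simp

/-- The coefficient of `x^{m'}` in `c·x^{mb} · g(xᵢ)`, for `mbᵢ = 0`: `c · g.coeff (m'ᵢ)` when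
`mb = m'.erase i`, and `0` otherwise. [folklore] -/
theorem coeff_monomial_mul_aeval_X_of_erase (mb : σ →₀ ℕ) (hmb : mb i = 0) (c : k)
    (g : Polynomial k) (m' : σ →₀ ℕ) :
    coeff m' (monomial mb c * Polynomial.aeval (X i : MvPolynomial σ k) g) =
      if mb = m'.erase i then c * g.coeff (m' i) else 0 := by
  rw [coeff_monomial_mul', coeff_aeval_X]
  by_cases h : mb = m'.erase i
  · rw [if_pos h, if_pos (h ▸ erase_le_self i m')]
    have hsub : m' - mb = Finsupp.single i (m' i) := by rw [h]; exact sub_erase_eq_single i m'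
    have hi : (m' - mb) i = m' i := by rw [hsub, Finsupp.single_eq_same]
    rw [hi, if_pos hsub]
  · rw [if_neg h]
    by_cases hle : mb ≤ m'
    · rw [if_pos hle, if_neg, mul_zero]
      intro hsub
      exact h (eq_erase_of_sub_eq_single i mb m' hmb hle hsub)
    · rw [if_neg hle]

/-- **Independence of slices**: if `∑_{mb ∈ T} x^{mb} · H_{mb}(xᵢ) = 0` and every `mb ∈ T` has
`mbᵢ = 0`, then `H_{mb} = 0` for all `mb ∈ T`. [OURS · L1 W4.5c] [folklore] -/
theorem sliced_eq_zero (T : Finset (σ →₀ ℕ)) (hT : ∀ mb ∈ T, mb i = 0)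
    (H : (σ →₀ ℕ) → Polynomial k)
    (hsum : ∑ mb ∈ T, monomial mb (1 : k) * Polynomial.aeval (X i : MvPolynomial σ k) (H mb) = 0) :
    ∀ mb ∈ T, H mb = 0 := by
  intro m₀ hm₀
  ext δ
  rw [Polynomial.coeff_zero]
  have h := congrArg (coeff (m₀ + Finsupp.single i δ)) hsum
  rw [coeff_sum, coeff_zero] at h
  rw [Finset.sum_eq_single m₀] at h
  · rw [coeff_monomial_mul_aeval_X_of_erase i m₀ (hT m₀ hm₀), if_pos, one_mul,
      Finsupp.add_apply, hT m₀ hm₀, Finsupp.single_eq_same, zero_add] at h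
    · exact h
    · ext l
      by_cases hl : l = i
      · subst hl; rw [Finsupp.erase_same]; exact hT m₀ hm₀
      · rw [Finsupp.erase_ne hl, Finsupp.add_apply, Finsupp.single_apply, if_neg (fun h => hl h.symm), add_zero]
  · intro mb hmb hne
    rw [coeff_monomial_mul_aeval_X_of_erase i mb (hT mb hmb), if_neg]
    intro heq
    apply hne
    rw [heq]
    ext l
    by_cases hl : l = i
    · subst hl; rw [Finsupp.erase_same]; exact (hT m₀ hm₀).symm
    · rw [Finsupp.erase_ne hl, Finsupp.add_apply, Finsupp.single_apply, if_neg (fun h => hl h.symm), add_zero]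
  · intro h0; exact absurd hm₀ h0

/-- The slice polynomial `P_{mb} = ∑_{a ≤ D} C (b.coeff (mb + a·eᵢ)) X^a`. [OURS · L1 W4.5c] -/
def slicePoly (b : MvPolynomial σ k) (D : ℕ) (mb : σ →₀ ℕ) : Polynomial k :=
  ∑ a ∈ Finset.range (D + 1), Polynomial.C (coeff (mb + Finsupp.single i a) b) * Polynomial.X ^ a

omit [DecidableEq σ] in
/-- Coefficients of the slice polynomial. [OURS · L1 W4.5c] -/
theorem coeff_slicePoly (b : MvPolynomial σ k) (D : ℕ) (mb : σ →₀ ℕ) (a : ℕ) :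
    (slicePoly i b D mb).coeff a = if a ≤ D then coeff (mb + Finsupp.single i a) b else 0 := by
  rw [slicePoly, Polynomial.finsetSum_coeff]
  simp_rw [Polynomial.coeff_C_mul, Polynomial.coeff_X_pow, mul_ite, mul_one, mul_zero]
  rw [Finset.sum_ite_eq (Finset.range (D + 1)) a]
  simp only [Finset.mem_range, Nat.lt_succ_iff]

omit [DecidableEq σ] in
/-- `natDegree (slicePoly b D mb) ≤ D`. [OURS · L1 W4.5c] -/
theorem natDegree_slicePoly_le (b : MvPolynomial σ k) (D : ℕ) (mb : σ →₀ ℕ) :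
    (slicePoly i b D mb).natDegree ≤ D := by
  rw [slicePoly]
  refine Polynomial.natDegree_sum_le_of_forall_le _ _ fun a ha => ?_
  have ha' : a ≤ D := Nat.lt_succ_iff.mp (Finset.mem_range.mp ha)
  exact (Polynomial.natDegree_C_mul_le _ _).trans ((Polynomial.natDegree_X_pow_le a).trans ha')

/-- **Decomposition into slices**: `b = ∑_{mb ∈ T} x^{mb} · P_{mb}(xᵢ)`, `T = supp(b).image (erase i)`,
as soon as `D` bounds the `xᵢ`-exponents of `b`. [OURS · L1 W4.5c] [folklore] -/
theorem eq_sum_slices (b : MvPolynomial σ k) (D : ℕ) (hD : ∀ m ∈ b.support, m i ≤ D) :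
    b = ∑ mb ∈ b.support.image (Finsupp.erase i),
      monomial mb (1 : k) * Polynomial.aeval (X i : MvPolynomial σ k) (slicePoly i b D mb) := by
  apply MvPolynomial.ext
  intro m'
  rw [coeff_sum]
  have hT : ∀ mb ∈ b.support.image (Finsupp.erase i), mb i = 0 := by
    intro mb hmb
    obtain ⟨m, _, rfl⟩ := Finset.mem_image.mp hmb
    exact Finsupp.erase_same
  -- only the slice `m'.erase i` contributes
  have hterm : ∀ mb ∈ b.support.image (Finsupp.erase i),
      coeff m' (monomial mb (1 : k) * Polynomial.aeval (X i : MvPolynomial σ k) (slicePoly i b D mb)) =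
        if mb = m'.erase i then (slicePoly i b D mb).coeff (m' i) else 0 := by
    intro mb hmb
    rw [coeff_monomial_mul_aeval_X_of_erase i mb (hT mb hmb), one_mul]
  rw [Finset.sum_congr rfl hterm, Finset.sum_ite_eq' (b.support.image (Finsupp.erase i)) (m'.erase i)]
  by_cases hm' : m' ∈ b.support
  · rw [if_pos (Finset.mem_image_of_mem _ hm'), coeff_slicePoly, if_pos (hD m' hm'),
      Finsupp.erase_add_single]
  · rw [notMem_support_iff.mp hm']
    split_ifs with h1
    · rw [coeff_slicePoly]
      split_ifs with h2
      · rw [Finsupp.erase_add_single]; exact (notMem_support_iff.mp hm').symm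
      · rfl
    · rfl

end Summit.ResolutionOfSingularities.ResolutionOfSingularities.Theorems.WildQuotientResolution.ConductorOne

end
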